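import Mathlib
import Literature.Computability.AlgebraicComplexity.PrattTrapezoidVal
import Literature.Computability.AlgebraicComplexity.PrattTrapezoidValBounds
import Summits.MatrixMultiplication.MatrixMultiplication.Theorems.EisensteinValCertificatesPrimeValSavingPointwiseLoads
import Summits.MatrixMultiplication.MatrixMultiplication.Theorems.EisensteinValCertificatesPrimeValSavingDisjointSquares
import Summits.MatrixMultiplication.MatrixMultiplication.Theorems.EisensteinValCertificatesPrimeValSavingPrimeDensity
import Summits.MatrixMultiplication.MatrixMultiplication.Theorems.EisensteinValCertificatesPrimeValSavingPollard

/-!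
# The sharp density threshold `1/3` and the constant `3^{-3/2}` at prime modulus

Seventh support file of the series for route `MatrixMultiplication/EisensteinValCertificates`
(cruxes `stmt-MatrixMultiplication-7788` `PrimeValSaving`, stmt-7790 `PrimeFourThirdsSaving`).
With Pollard's theorem (`PrattValPollard.pollard`) the density threshold `2/5` of
`…PrimeValSavingPrimeDensity` becomes SHARP:

* `card_popular_add` — for a trapezoid-free `(A, B, C)` in `ℤ/p` and `1 ≤ t ≤ min(#A, #B)`, any `ρ`:
  `t·#C + t·min(p, #A + #B − t) ≤ t·p + t·⌊#A#B/ρ²⌋ + ρ·p`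
  (the `C`-lines of load `> ρ` are at most `#A#B/ρ²` by the disjoint squares, and by Pollard at
  least `min(p, #A+#B−t) − ρp/t` elements of `ℤ/p` are `ρ`-popular sums of `A + B`).
* `three_mul_min_card_le` : `3·min(#A,#B,#C) ≤ p + 4t + 3⌊ρp/t⌋ + 3⌊p²/ρ²⌋` for all `t, ρ ≥ 1`
  (with `t ≈ p^{4/5}`, `ρ ≈ p^{3/5}`: `min ≤ p/3 + O(p^{4/5})` — sharp, since `A = B = C ⊂ (p/3, 2p/3)`
  is (vacuously) trapezoid-free; in `ℤ/2m` the odd residues give `1/2`).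
* `card_sq_le` : `27·T² ≤ (p + S)³ + 27·p²·S`, `S = t + ⌊p²/ρ²⌋ + ⌊ρp/t⌋`, for the number `T` of
  solutions, and `prattVal_sq_le` for `Val(ℤ/p)`: `Val(ℤ/p) ≤ (3^{-3/2} + o(1)) p^{3/2} ≈ 0.192 p^{3/2}`
  (Pratt Prop. 3.4: `≤ p^{3/2}`; `PrattValConstant.prattVal_le_rpow`: `≤ 0.354 |G|^{3/2}` in every
  abelian group, attained in `ℤ/8`).  The `∀ ε` forms are in the companion file `…PrimeThirdEpsilon`.

Only system 1 of Def. 3.2 enters (through `∑_c r(c)² ≤ #A·#B`), plus Pollard.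
[cite: Pratt2024, Def. 3.2, Prop. 3.1, Prop. 3.4] [cite: Pollard1974, Thm. 1]
-/

-- single-conjunct summit: the mandated namespace repeats `MatrixMultiplication`.
set_option linter.dupNamespace false

namespace Summit.MatrixMultiplication.MatrixMultiplication.Theorems

namespace PrattValPrimeThird

open Finset Literature.Computability.AlgebraicComplexity PrattValPointwiseLoads PrattValDisjointSquares
  PrattValPrimeDensity PrattValPollard

variable {p : ℕ} [hp : Fact p.Prime] {A B C : Finset (ZMod p)}

/-- The number of `ρ`-popular `C`-line labels equals the number of `ρ`-popular sums of `A + B`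
(`c ↦ -c`). [folklore] -/
theorem card_popular_neg (A B : Finset (ZMod p)) (ρ : ℕ) :
    #((univ : Finset (ZMod p)).filter fun c => ρ < #(A.filter fun a => -(a + c) ∈ B)) =
      #((univ : Finset (ZMod p)).filter fun x => ρ < #(A.filter fun a => x - a ∈ B)) := by
  refine card_bij' (fun c _ => -c) (fun x _ => -x) ?_ ?_ ?_ ?_
  · intro c hc
    have hc' := (mem_filter.1 hc).2
    refine mem_filter.2 ⟨mem_univ _, ?_⟩
    have e : (A.filter fun a => -c - a ∈ B) = A.filter fun a => -(a + c) ∈ B :=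
      filter_congr fun a _ => by rw [show -c - a = -(a + c) by abel]
    rw [e]; exact hc'
  · intro x hx
    have hx' := (mem_filter.1 hx).2
    refine mem_filter.2 ⟨mem_univ _, ?_⟩
    have e : (A.filter fun a => -(a + -x) ∈ B) = A.filter fun a => x - a ∈ B :=
      filter_congr fun a _ => by rw [show -(a + -x) = x - a by abel]
    rw [e]; exact hx'
  · intro c _; simp
  · intro x _; simp

/-- **Pollard meets the disjoint squares.** For a trapezoid-free `(A, B, C)` in `ℤ/p`,
`1 ≤ t ≤ min(#A, #B)` and any `ρ`:
`t·#C + t·min(p, #A + #B − t) ≤ t·p + t·⌊#A·#B/ρ²⌋ + ρ·p`. [cite: Pratt2024, Prop. 3.1]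
[cite: Pollard1974, Thm. 1] -/
theorem card_popular_add (h : IsEquilateralTrapezoidFree A B C) {t ρ : ℕ} (ht : 1 ≤ t)
    (hρ : 1 ≤ ρ) (htA : t ≤ #A) (htB : t ≤ #B) :
    t * #C + t * min p (#A + #B - t) ≤ t * p + t * (#A * #B / ρ ^ 2) + ρ * p := by
  -- popular / unpopular split of `C`
  set Pop := (univ : Finset (ZMod p)).filter fun c => ρ < #(A.filter fun a => -(a + c) ∈ B) with hPop
  have hCsplit : #C ≤ #(C.filter fun c => ρ < #(A.filter fun a => -(a + c) ∈ B)) + #(univ \ Pop) := by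
    calc #C = #(C.filter fun c => ρ < #(A.filter fun a => -(a + c) ∈ B)) +
          #(C.filter fun c => ¬ ρ < #(A.filter fun a => -(a + c) ∈ B)) :=
          (card_filter_add_card_filter_not _).symm
      _ ≤ _ := Nat.add_le_add_left (card_le_card fun c hc => by
          rw [mem_sdiff, hPop, mem_filter]
          exact ⟨mem_univ _, fun h' => (mem_filter.1 hc).2 h'.2⟩) _
  have hpopC : #(C.filter fun c => ρ < #(A.filter fun a => -(a + c) ∈ B)) ≤ #A * #B / ρ ^ 2 := by
    rw [Nat.le_div_iff_mul_le (by positivity)]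
    exact card_popular_mul_sq_le h ρ
  have hunpop : #(univ \ Pop) + #Pop = p := by
    rw [card_univ_sdiff, Nat.sub_add_cancel (card_le_univ _), ZMod.card]
  have hPol : t * min p (#A + #B - t) ≤ t * #Pop + ρ * p := by
    have key := pollard A B ht htA htB
    have hmin : min (t * p) (t * (#A + #B - t)) = t * min p (#A + #B - t) := by
      rcases le_total p (#A + #B - t) with h' | h'
      · rw [min_eq_left h', min_eq_left (Nat.mul_le_mul_left t h')]
      · rw [min_eq_right h', min_eq_right (Nat.mul_le_mul_left t h')]
    rw [hmin] at key
    rw [hPop, card_popular_neg]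
    refine key.trans ?_
    -- split the Pollard sum into popular and unpopular `x`
    set P := (univ : Finset (ZMod p)).filter fun x => ρ < #(A.filter fun a => x - a ∈ B) with hP
    have hsplit : ∑ x, min t #(A.filter fun a => x - a ∈ B) =
        ∑ x ∈ P, min t #(A.filter fun a => x - a ∈ B) +
        ∑ x ∈ univ.filter (fun x => ¬ ρ < #(A.filter fun a => x - a ∈ B)),
          min t #(A.filter fun a => x - a ∈ B) := by
      rw [hP, sum_filter_add_sum_filter_not]
    rw [hsplit]
    refine Nat.add_le_add ?_ ?_
    · calc ∑ x ∈ P, min t #(A.filter fun a => x - a ∈ B) ≤ ∑ x ∈ P, t :=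
            sum_le_sum fun x _ => min_le_left _ _
        _ = t * #P := by rw [sum_const, smul_eq_mul, Nat.mul_comm]
    · calc ∑ x ∈ univ.filter (fun x => ¬ ρ < #(A.filter fun a => x - a ∈ B)),
            min t #(A.filter fun a => x - a ∈ B)
          ≤ ∑ x ∈ univ.filter (fun x => ¬ ρ < #(A.filter fun a => x - a ∈ B)), ρ :=
            sum_le_sum fun x hx => (min_le_right _ _).trans (not_lt.1 (mem_filter.1 hx).2)
        _ = ρ * #(univ.filter (fun x => ¬ ρ < #(A.filter fun a => x - a ∈ B))) := by
            rw [sum_const, smul_eq_mul, Nat.mul_comm]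
        _ ≤ ρ * p := Nat.mul_le_mul_left _ ((card_le_univ _).trans (ZMod.card p).le)
  -- assemble: `t·#C ≤ t·(pop) + t·(p − #Pop)`
  have h1 : t * #C ≤ t * (#A * #B / ρ ^ 2) + t * #(univ \ Pop) := by
    calc t * #C ≤ t * (#(C.filter fun c => ρ < #(A.filter fun a => -(a + c) ∈ B)) + #(univ \ Pop)) :=
          Nat.mul_le_mul_left _ hCsplit
      _ ≤ t * (#A * #B / ρ ^ 2 + #(univ \ Pop)) := Nat.mul_le_mul_left _ (Nat.add_le_add_right hpopC _)
      _ = _ := Nat.mul_add _ _ _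
  have h2 : t * #(univ \ Pop) + t * #Pop = t * p := by rw [← Nat.mul_add, hunpop]
  omega

/-- AM–GM for three naturals: `27abc ≤ (a+b+c)³`. [folklore] -/
theorem amgm_three (a b c : ℕ) : 27 * (a * b * c) ≤ (a + b + c) ^ 3 := by
  have key : (27 : ℤ) * (a * b * c) ≤ ((a : ℤ) + b + c) ^ 3 := by
    nlinarith [mul_nonneg (by positivity : (0:ℤ) ≤ (a:ℤ) + b + c) (sq_nonneg ((a:ℤ) - b)),
      mul_nonneg (by positivity : (0:ℤ) ≤ (a:ℤ) + b + c) (sq_nonneg ((b:ℤ) - c)),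
      mul_nonneg (by positivity : (0:ℤ) ≤ (a:ℤ) + b + c) (sq_nonneg ((c:ℤ) - a)),
      mul_nonneg (Int.natCast_nonneg a) (sq_nonneg ((b:ℤ) - c)),
      mul_nonneg (Int.natCast_nonneg b) (sq_nonneg ((c:ℤ) - a)),
      mul_nonneg (Int.natCast_nonneg c) (sq_nonneg ((a:ℤ) - b))]
  exact_mod_cast key

/-- From `t·X ≤ t·Y + R` (`t ≥ 1`) conclude `X ≤ Y + ⌊R/t⌋`. [folklore] -/
theorem le_add_div_of_mul_le {t X Y R : ℕ} (ht : 1 ≤ t) (h : t * X ≤ t * Y + R) :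
    X ≤ Y + R / t := by
  have h1 : t * (X - Y) ≤ R := by rw [Nat.mul_sub]; omega
  have h2 : X - Y ≤ R / t := by
    rw [Nat.le_div_iff_mul_le (by omega), Nat.mul_comm]; exact h1
  omega

/-- **Density sum bound at prime modulus.** For a trapezoid-free `(A, B, C)` in `ℤ/p` and
`t, ρ ≥ 1` with `t ≤ min(#A, #B)`: either `#A + #B + #C ≤ p + t + ⌊#A#B/ρ²⌋ + ⌊ρp/t⌋`
(when `#A + #B ≤ p + t`) or `#C ≤ ⌊#A#B/ρ²⌋ + ⌊ρp/t⌋`. [cite: Pratt2024, Prop. 3.1]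
[cite: Pollard1974, Thm. 1] -/
theorem card_sum_le_or (h : IsEquilateralTrapezoidFree A B C) {t ρ : ℕ} (ht : 1 ≤ t) (hρ : 1 ≤ ρ)
    (htA : t ≤ #A) (htB : t ≤ #B) :
    (#A + #B ≤ p + t ∧ #A + #B + #C ≤ p + t + #A * #B / ρ ^ 2 + ρ * p / t) ∨
      (p + t < #A + #B ∧ #C ≤ #A * #B / ρ ^ 2 + ρ * p / t) := by
  have key := card_popular_add h ht hρ htA htB
  by_cases hcase : #A + #B ≤ p + t
  · left
    refine ⟨hcase, ?_⟩
    rw [min_eq_right (by omega)] at key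
    have : t * (#A + #B + #C) ≤ t * (p + t + #A * #B / ρ ^ 2) + ρ * p := by
      have e : t * (#A + #B + #C) = t * #C + t * (#A + #B - t) + t * t := by
        rw [← Nat.mul_add, ← Nat.mul_add]; congr 1; omega
      rw [e]; nlinarith [key]
    exact le_add_div_of_mul_le ht this
  · right
    rw [not_le] at hcase
    refine ⟨hcase, ?_⟩
    rw [min_eq_left (by omega)] at key
    exact le_add_div_of_mul_le ht (by nlinarith [key])

/-- **Sharp density threshold (explicit form).** For a trapezoid-free `(A, B, C)` in `ℤ/p` and all
`t, ρ ≥ 1`: `3·min(#A, #B, #C) ≤ p + 4t + 3⌊ρp/t⌋ + 3⌊p²/ρ²⌋`. [cite: Pratt2024, Def. 3.2]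
[cite: Pollard1974, Thm. 1] -/
theorem three_mul_min_card_le (h : IsEquilateralTrapezoidFree A B C) {t ρ : ℕ} (ht : 1 ≤ t)
    (hρ : 1 ≤ ρ) :
    3 * min (min #A #B) #C ≤ p + 4 * t + 3 * (ρ * p / t) + 3 * (p ^ 2 / ρ ^ 2) := by
  set m := min (min #A #B) #C with hm
  have hmA : m ≤ #A := (min_le_left _ _).trans (min_le_left _ _)
  have hmB : m ≤ #B := (min_le_left _ _).trans (min_le_right _ _)
  have hmC : m ≤ #C := min_le_right _ _
  have hAp : #A ≤ p := (card_le_univ _).trans (ZMod.card p).le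
  have hBp : #B ≤ p := (card_le_univ _).trans (ZMod.card p).le
  have hCp : #C ≤ p := (card_le_univ _).trans (ZMod.card p).le
  have hq : #A * #B / ρ ^ 2 ≤ p ^ 2 / ρ ^ 2 :=
    Nat.div_le_div_right ((Nat.mul_le_mul hAp hBp).trans (sq p).symm.le)
  by_cases hmt : m < t
  · generalize p ^ 2 / ρ ^ 2 = q₂
    generalize ρ * p / t = d
    omega
  · rw [not_lt] at hmt
    have hcases := card_sum_le_or h ht hρ (hmt.trans hmA) (hmt.trans hmB)
    generalize hq1 : #A * #B / ρ ^ 2 = q₁ at hq hcases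
    generalize hq2 : p ^ 2 / ρ ^ 2 = q₂ at hq hcases
    generalize hd : ρ * p / t = d at hcases
    rcases hcases with ⟨-, hs⟩ | ⟨-, hs⟩
    · omega
    · omega

/-- **Counting bound at prime modulus.** For a trapezoid-free `(A, B, C)` in `ℤ/p` with `T`
solutions and all `t, ρ ≥ 1`: `27·T² ≤ (p + S)³ + 27·p²·S` where `S = t + ⌊p²/ρ²⌋ + ⌊ρp/t⌋`
(Prop. 3.1's `T² ≤ #A#B#C`, the density sum bound and AM–GM). [cite: Pratt2024, Prop. 3.1, 3.4]
[cite: Pollard1974, Thm. 1] -/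
theorem card_sq_le (h : IsEquilateralTrapezoidFree A B C) {t ρ : ℕ} (ht : 1 ≤ t) (hρ : 1 ≤ ρ) :
    27 * #(zeroSumTriples A B C) ^ 2 ≤
      (p + (t + p ^ 2 / ρ ^ 2 + ρ * p / t)) ^ 3 + 27 * p ^ 2 * (t + p ^ 2 / ρ ^ 2 + ρ * p / t) := by
  set S := t + p ^ 2 / ρ ^ 2 + ρ * p / t with hS
  have hT : #(zeroSumTriples A B C) ^ 2 ≤ #A * #B * #C := h.card_zeroSumTriples_sq_le
  have hAp : #A ≤ p := (card_le_univ _).trans (ZMod.card p).le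
  have hBp : #B ≤ p := (card_le_univ _).trans (ZMod.card p).le
  have hCp : #C ≤ p := (card_le_univ _).trans (ZMod.card p).le
  have hq : #A * #B / ρ ^ 2 ≤ p ^ 2 / ρ ^ 2 :=
    Nat.div_le_div_right ((Nat.mul_le_mul hAp hBp).trans (sq p).symm.le)
  -- either some set is smaller than `t`, or the density sum bound applies
  by_cases hsmall : #A < t ∨ #B < t ∨ #C < t
  · -- then `#A·#B·#C ≤ t·p²`
    have habc : #A * #B * #C ≤ p ^ 2 * S := by
      have hSt : t ≤ S := by
        rw [hS]; exact (Nat.le_add_right t _).trans (Nat.le_add_right _ _)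
      rcases hsmall with ha | hb | hc
      · calc #A * #B * #C ≤ t * p * p :=
            Nat.mul_le_mul (Nat.mul_le_mul ha.le hBp) hCp
          _ = p ^ 2 * t := by ring
          _ ≤ p ^ 2 * S := Nat.mul_le_mul_left _ hSt
      · calc #A * #B * #C ≤ p * t * p :=
            Nat.mul_le_mul (Nat.mul_le_mul hAp hb.le) hCp
          _ = p ^ 2 * t := by ring
          _ ≤ p ^ 2 * S := Nat.mul_le_mul_left _ hSt
      · calc #A * #B * #C ≤ p * p * t :=
            Nat.mul_le_mul (Nat.mul_le_mul hAp hBp) hc.le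
          _ = p ^ 2 * t := by ring
          _ ≤ p ^ 2 * S := Nat.mul_le_mul_left _ hSt
    calc 27 * #(zeroSumTriples A B C) ^ 2 ≤ 27 * (p ^ 2 * S) :=
          Nat.mul_le_mul_left _ (hT.trans habc)
      _ = 27 * p ^ 2 * S := by ring
      _ ≤ _ := Nat.le_add_left _ _
  · push Not at hsmall
    obtain ⟨htA, htB, htC⟩ := hsmall
    rcases card_sum_le_or h ht hρ htA htB with ⟨-, hs⟩ | ⟨-, hs⟩
    · have hsum : #A + #B + #C ≤ p + S := by
        generalize hq1 : #A * #B / ρ ^ 2 = q₁ at hq hs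
        generalize hq2 : p ^ 2 / ρ ^ 2 = q₂ at hq hs hS
        generalize hd : ρ * p / t = d at hs hS
        omega
      have h27 := amgm_three #A #B #C
      have hpow : (#A + #B + #C) ^ 3 ≤ (p + S) ^ 3 := Nat.pow_le_pow_left hsum 3
      calc 27 * #(zeroSumTriples A B C) ^ 2 ≤ 27 * (#A * #B * #C) := Nat.mul_le_mul_left _ hT
        _ ≤ (#A + #B + #C) ^ 3 := h27
        _ ≤ (p + S) ^ 3 := hpow
        _ ≤ _ := Nat.le_add_right _ _
    · have hC : #C ≤ S := by
        generalize hq1 : #A * #B / ρ ^ 2 = q₁ at hq hs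
        generalize hq2 : p ^ 2 / ρ ^ 2 = q₂ at hq hs hS
        generalize hd : ρ * p / t = d at hs hS
        omega
      have habc : #A * #B * #C ≤ p ^ 2 * S := by
        calc #A * #B * #C ≤ p * p * S := Nat.mul_le_mul (Nat.mul_le_mul hAp hBp) hC
          _ = p ^ 2 * S := by ring
      calc 27 * #(zeroSumTriples A B C) ^ 2 ≤ 27 * (p ^ 2 * S) :=
            Nat.mul_le_mul_left _ (hT.trans habc)
        _ = 27 * p ^ 2 * S := by ring
        _ ≤ _ := Nat.le_add_left _ _

/-- **The same for `Val`**: `27·Val(ℤ/p)² ≤ (p + S)³ + 27·p²·S` for all `t, ρ ≥ 1`.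
[cite: Pratt2024, Prop. 3.4] [cite: Pollard1974, Thm. 1] -/
theorem prattVal_sq_le (p : ℕ) [Fact p.Prime] {t ρ : ℕ} (ht : 1 ≤ t) (hρ : 1 ≤ ρ) :
    27 * prattVal (ZMod p) ^ 2 ≤
      (p + (t + p ^ 2 / ρ ^ 2 + ρ * p / t)) ^ 3 + 27 * p ^ 2 * (t + p ^ 2 / ρ ^ 2 + ρ * p / t) := by
  obtain ⟨A, B, C, h, hk⟩ := exists_prattVal_eq (G := ZMod p)
  rw [← hk]
  exact card_sq_le h ht hρ


end PrattValPrimeThird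

end Summit.MatrixMultiplication.MatrixMultiplication.Theorems
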